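import Summits.ResolutionOfSingularities.ResolutionOfSingularities.Theorems.EquisingularLiftEquisingularLiftBertiniBaseCurveCount
import HarnessLib

/-!
# Crux `EquisingularLift` (stmt-ResolutionOfSingularities-15660), line `Sketch`:
# stub `stub_bertiniWithBaseCurve` (Bertini for a linear system with a base curve)

[OURS · L1 W4.5b] Move-set stub 6 of the registered skeleton `Cruxes/EquisingularLift/Lines/Sketch.lean`
(idea card `linked-ci-centres`, lemma 1); NOT a statement of any manuscript.

**Statement.** `A` a regular algebra of finite type over an algebraically closed field `k`, `𝔭` a prime
with `dim A/𝔭 ≤ 1` (the base curve `Σ = V(𝔭)`), `u : ι → A` finitely many sections vanishing on `Σ`;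
off `Σ` the map `t ↦ s_t mod 𝔪²` (`s_t = Σ tⱼ uⱼ`) is surjective onto `A/𝔪²`, on `Σ` its range has
rank `≥ 2`. Then for generic `t` the member `V(s_t)` is regular at every closed point it passes
through: `A_𝔪 ⧸ (s_t)` is a regular local ring for every maximal `𝔪 ∋ s_t`.

**Proof** (the architecture of the tree's `BertiniAffine.isGeneric_isRegularLocalRing_quotient_linComb`,
Hartshorne II.8.18): the bad locus of `Spec B → Spec k[a]` (`B = A[a]/(Σ aⱼ uⱼ)` the incidence ring)
lies in the closed non-smooth locus (`BertiniAffine.isSmoothAt_pointIdeal`); by the dimension count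
WITH A BASE CURVE (`under_paramRing_ne_bot_baseCurve`: off `Σ` Hartshorne's count, on `Σ` the rank-`2`
condition against `dim Σ ≤ 1`) none of its finitely many components dominates `Spec k[a]`, so a
non-zero polynomial `Φ` vanishes on its image; off `V(Φ)` every closed point `(t, 𝔪)` is smooth, and
smooth points have regular hyperplane sections (`BertiniAffine.isRegularLocalRing_of_isSmoothAt_pointIdeal`).
The hypothesis `uⱼ ∈ 𝔭` of the registered signature is not needed.
-/

set_option linter.dupNamespace false -- mandated namespace `Summit.<Summit>.<Problem>` of this single-conjunct summit

noncomputable section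

open IsLocalRing MvPolynomial

universe u v

namespace Summit.ResolutionOfSingularities.ResolutionOfSingularities.Cruxes.EquisingularLift.StrataSplit

open Literature.AlgebraicGeometry.Resolution Literature.AlgebraicGeometry.Resolution.BertiniAffine

variable {k : Type u} [Field k] {A : Type u} [CommRing A] [Algebra k A]
variable {ι : Type v} [Fintype ι] (u : ι → A)

set_option synthInstance.maxHeartbeats 80000 in
/-- **Bertini's theorem for hyperplane sections with a base curve, affine local-algebra form.**
Let `A` be a regular algebra of finite type over an algebraically closed field `k`, `𝔭` a prime with
`dim A/𝔭 ≤ 1`, and `u : ι → A` finitely many functions such that `t ↦ Σ tⱼ uⱼ mod 𝔪²`, `kᶥ → A ⧸ 𝔪²`,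
is surjective at every closed point `𝔪 ⊉ 𝔭` and has range of rank `≥ 2` at every closed point
`𝔪 ⊇ 𝔭`. Then for generic `t ∈ kᶥ` (off the zeros of a non-zero polynomial) the hyperplane section
`V(s_t)`, `s_t = Σ tⱼ uⱼ`, is regular at all its closed points: `A_𝔪 ⧸ (s_t)` is a regular local ring
for every maximal `𝔪 ∋ s_t`. [cite: Hartshorne1977, II Thm. 8.18 (proof)] -/
theorem isGeneric_isRegularLocalRing_quotient_linComb_baseCurve [IsAlgClosed k] [IsRegularRing A]
    [Algebra.FiniteType k A] (𝔭 : Ideal A) [𝔭.IsPrime] (hdim : ringKrullDim (A ⧸ 𝔭) ≤ 1)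
    (hoff : ∀ 𝔪 : Ideal A, 𝔪.IsMaximal → ¬ 𝔭 ≤ 𝔪 →
      Function.Surjective (linCombQuotSq (k := k) u 𝔪))
    (hon : ∀ 𝔪 : Ideal A, 𝔪.IsMaximal → 𝔭 ≤ 𝔪 →
      2 ≤ Module.finrank k (LinearMap.range (linCombQuotSq (k := k) u 𝔪))) :
    IsGeneric fun t : ι → k => ∀ (𝔪 : Ideal A) [𝔪.IsMaximal], linComb u t ∈ 𝔪 →
      IsRegularLocalRing (Localization.AtPrime 𝔪 ⧸
        Ideal.span {algebraMap A (Localization.AtPrime 𝔪) (linComb u t)}) := by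
  classical
  letI : Algebra (MvPolynomial ι k) (MvPolynomial ι A) := MvPolynomial.algebraMvPolynomial
  let R := MvPolynomial ι k
  haveI : Algebra.FiniteType R (Inc u) :=
    Algebra.FiniteType.of_restrictScalars_finiteType k R (Inc u)
  haveI : Algebra.FinitePresentation R (Inc u) :=
    (Algebra.FinitePresentation.of_finiteType (R := R) (A := Inc u)).mp inferInstance
  -- the bad (= non-smooth) locus `V(J₀)` and its finitely many components
  have hcl : IsClosed (Algebra.smoothLocus R (Inc u))ᶜ :=
    (Algebra.isOpen_smoothLocus (R := R) (A := Inc u)).isClosed_compl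
  obtain ⟨J₀, hJ₀⟩ := (PrimeSpectrum.isClosed_iff_zeroLocus_ideal _).mp hcl
  have hfin : J₀.minimalPrimes.Finite := Ideal.finite_minimalPrimes_of_isNoetherianRing _ J₀
  have hmemBad : ∀ {t : ι → k} {𝔪 : Ideal A} [(pointIdeal u t 𝔪).IsPrime],
      ¬ Algebra.IsSmoothAt R (pointIdeal u t 𝔪) → J₀ ≤ pointIdeal u t 𝔪 := by
    intro t 𝔪 _ hns
    have hmem : (⟨pointIdeal u t 𝔪, inferInstance⟩ : PrimeSpectrum (Inc u)) ∈
        PrimeSpectrum.zeroLocus (J₀ : Set (Inc u)) := by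
      rw [← hJ₀]; exact hns
    exact fun x hx => hmem hx
  -- no component of the bad locus dominates the parameter space (the count with a base curve)
  have hne : ∀ 𝔔 ∈ J₀.minimalPrimes, ∃ g : R, g ≠ 0 ∧
      Ideal.Quotient.mk (Ideal.span {univComb u}) (MvPolynomial.map (algebraMap k A) g) ∈ 𝔔 := by
    intro 𝔔 h𝔔
    haveI : 𝔔.IsPrime := h𝔔.1.1
    refine under_paramRing_ne_bot_baseCurve u 𝔭 hdim hoff hon 𝔔 fun t 𝔪 _ hst hle => ?_
    by_contra hst2
    haveI := isMaximal_pointIdeal u hst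
    have hsm := isSmoothAt_pointIdeal (u := u) hst hst2
    have hns : ¬ Algebra.IsSmoothAt R (pointIdeal u t 𝔪) := fun h => by
      have hmem : (⟨pointIdeal u t 𝔪, inferInstance⟩ : PrimeSpectrum (Inc u)) ∈
          (Algebra.smoothLocus R (Inc u))ᶜ := by
        rw [hJ₀]
        intro x hx
        exact hle (h𝔔.1.2 hx)
      exact hmem h
    exact hns hsm
  -- the polynomial `Φ`: a product of non-zero elements of the `𝔔 ∩ k[a]`
  haveI : Fintype J₀.minimalPrimes := hfin.fintype
  have hg : ∀ q : J₀.minimalPrimes, ∃ g : R, g ∈ (q : Ideal (Inc u)).under R ∧ g ≠ 0 := fun q => by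
    obtain ⟨g, hg0, hg⟩ := hne q.1 q.2
    refine ⟨g, ?_, hg0⟩
    rw [Ideal.under_def, Ideal.mem_comap, algebraMap_paramRing_inc, MvPolynomial.algebraMap_def]
    exact hg
  choose g hgmem hg0 using hg
  refine ⟨∏ q, g q, Finset.prod_ne_zero_iff.2 fun q _ => hg0 q, fun t ht 𝔪 h𝔪 hst => ?_⟩
  haveI := isMaximal_pointIdeal u hst
  -- `𝔔_{t,𝔪}` is a smooth point of `Spec B → Spec k[a]`
  have hsm : Algebra.IsSmoothAt R (pointIdeal u t 𝔪) := by
    by_contra hns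
    obtain ⟨𝔔, h𝔔min, h𝔔le⟩ := Ideal.exists_minimalPrimes_le (hmemBad hns)
    have h1 : g ⟨𝔔, h𝔔min⟩ ∈ (pointIdeal u t 𝔪).under R :=
      Ideal.comap_mono h𝔔le (hgmem ⟨𝔔, h𝔔min⟩)
    rw [under_pointIdeal_paramRing u hst, mem_paramIdeal_iff] at h1
    apply ht
    rw [map_prod]
    exact Finset.prod_eq_zero (Finset.mem_univ _) h1
  exact isRegularLocalRing_of_isSmoothAt_pointIdeal (u := u) hst hsm

/-- **STUB `stub_bertiniWithBaseCurve`** (Bertini with a base curve, affine local-algebra form;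
registered stub of the line `Sketch` for the crux `EquisingularLift`, stmt-ResolutionOfSingularities-15660).
`A` a regular algebra of finite type over an algebraically closed field `k`, `𝔭` a prime with
`dim A/𝔭 ≤ 1` (the base curve `Σ`), `u : ι → A` sections vanishing on `Σ`; off `Σ` they fill `A/𝔪²`,
on `Σ` they give `≥ 2` independent directions in `𝔪/𝔪²`. Then for generic `t` the member
`V(Σ tⱼ uⱼ)` is regular at every closed point it passes through. [OURS · L1 W4.5b]
[cite: Hartshorne1977, II Thm. 8.18 (proof)] -/
theorem stub_bertiniWithBaseCurve : ∀ (k : Type) [Field k] [IsAlgClosed k] (A : Type) [CommRing A] [Algebra k A] [IsRegularRing A] [Algebra.FiniteType k A] (ι : Type) [Fintype ι] (u : ι → A) (𝔭 : Ideal A) [𝔭.IsPrime], (∀ j, u j ∈ 𝔭) → ringKrullDim (A ⧸ 𝔭) ≤ 1 → (∀ 𝔪 : Ideal A, 𝔪.IsMaximal → ¬ 𝔭 ≤ 𝔪 → Function.Surjective (Literature.AlgebraicGeometry.Resolution.BertiniAffine.linCombQuotSq (k := k) u 𝔪)) → (∀ 𝔪 : Ideal A, 𝔪.IsMaximal → 𝔭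 ≤ 𝔪 → 2 ≤ Module.finrank k (LinearMap.range (Literature.AlgebraicGeometry.Resolution.BertiniAffine.linCombQuotSq (k := k) u 𝔪))) → Literature.AlgebraicGeometry.Resolution.IsGeneric fun t : ι → k => ∀ (𝔪 : Ideal A) [𝔪.IsMaximal], Literature.AlgebraicGeometry.Resolution.BertiniAffine.linComb u t ∈ 𝔪 → IsRegularLocalRing (Localization.AtPrime 𝔪 ⧸ Ideal.span {algebraMap A (Localization.AtPrime 𝔪) (Literature.AlgebraicGeometry.Resolution.BertiniAffine.linComb u t)}) :=
  fun _ _ _ _ _ _ _ _ _ _ u 𝔭 _ _ hdim hoff hon =>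
    isGeneric_isRegularLocalRing_quotient_linComb_baseCurve u 𝔭 hdim hoff hon

end Summit.ResolutionOfSingularities.ResolutionOfSingularities.Cruxes.EquisingularLift.StrataSplit

end
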